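import Summits.Parity.GeneralizedHardyLittlewood.Theorems.PrimeLevelFamEdgeMomentsBeyondDiagonalDiagDecorPrimeSqTerm
import HarnessLib

/-!
# Route `PrimeLevelFamEdge`, crux K_A `MomentsBeyondDiagonal` (stmt-Parity-20007), line «petersson_layers» v4, stub `stub_diag`:
# **the prime-square decorated coprime Selberg sum:
# `Σ_{k≤y,(k,n)=1} τ(k)W(k)·P₂(k)·logᶜ(y/k) = −2·E_n·logᶜy + O_c(D(n)(1+κ(n))(1+log y)^{c−1})`**, `P₂(k) = Σ_{p∣k} log²p`, `c ≥ 2`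

Census R3(ii), ANALYTIC HALF, first decorated engine (the arithmetic input of rung `N = 1` = order `(1,1)` of the
exact remaining list `Cruxes/MomentsBeyondDiagonal/Lines/petersson_layers_stub_diag_g8_orders.md`). On squarefree `k`
`τ_{1,1}(k) = τ(k)(log²k − P₂(k))/4` and `τ_{2,0}(k) = τ(k)(log²k + P₂(k))/4` (`…DiagDecorMult`, `…DiagDecorTau2`); the
`log²k` part is free (`…DiagDecorTools.sum_mul_log_pow_mul_log_div_pow_eq` + the undecorated engines), and this file
evaluates the ADDITIVE prime-square part `P₂(k) = Σ_{p∣k}log²p` against the Selberg weights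
`a_n(k) = copTauW n k = τ(k)W(k)[(k,n)=1]` of the `X²` chain at every order `c ≥ 2`, to relative precision `1/log y`,
by summing the per-prime bounds of `…DiagDecorPrimeSqTerm` over `p ≤ y`:

* `abs_coprimeSumPow_primeSq_add_le` — **for `c ≥ 3`: `|Σ_{k≤y} a_n(k)·logᶜ(y/k)·P₂(k) + 2E_n logᶜy| ≤
  C_c·D(n)(1+κ(n))(1+log y)^{c−1}`** (`y ≥ 1`, `n ≥ 1`): the prime sum `Σ_{p≤y} log²p·a_n(p)·S⁽ᶜ⁾(y/p; np)`
  (`…DiagDecorPrime`), the termwise evaluation `abs_primeSq_term_sub_le`, the main part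
  `abs_sum_primeWeight_log_mul_log_pow_sub_le`, and `Σ_{p≤y,p∤n}log p/(p+1) ≤ log y + log 4`
  (`KernelFormXSqSumsB.sum_prime_log_div_succ_le`) for the error;
* `abs_coprimeSum_primeSq_add_le` — **the same at `c = 2`: `|Σ_{k≤y} a_n(k)·log²(y/k)·P₂(k) + 2E_n log²y| ≤
  C·D(n)(1+κ(n))(1+log y)`** (termwise `abs_primeSq_term_two_sub_le`, error through the dyadic prime sum
  `sum_prime_log_div_dyadic_le`).

So `Σ_{k≤y,(k,n)=1} W(k)τ_{1,1}(k)logᶜ(y/k) = E_n logᶜy·(1 + O(1/log y))` while the `τ_{2,0}`-decorated sum is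
`O(E_n log^{c−1}y)` (its naive leading term cancels): the relative precision `1/log` of the existing engines is exactly
what the per-order targets of `…DiagOrderSelberg` consume (one log below the main term `2ζ(2)²q̂/(Δ'²ℓ²)·τ_{ij}`).
Def-free; theorems only. Helper `--supports stmt-Parity-20007`; closes nothing; K_A, K_B and the Parity summit are NOT
proved; nothing about Landau–Siegel zeros.

## References
* E. Kowalski, P. Michel, J. VanderKam, J. reine angew. Math. 526 (2000), (23)–(28) pp. 13–15 and Prop. 5.1 p. 18
  (the residue evaluation of the diagonal main term; here the log-decorations of a general `Q` in real variables).
  [cite: KowalskiMichelVanderKam2000, (23)–(28) — derivation (prime-square decoration of the Selberg coordinates)]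
* T. M. Apostol, *Introduction to Analytic Number Theory*, Springer 1976, Thm 4.9 (Mertens). [cite: Apostol1976, Thm 4.9 — derivation]
-/

noncomputable section

open scoped Real
open Finset ArithmeticFunction

namespace Summit.Parity.GeneralizedHardyLittlewood.Theorems.MomentsBeyondDiagonal.DiagKernel

open Literature.NumberTheory.LFunctions Literature.NumberTheory.LFunctions.KMV2000
open SelbergCoord (kappa)
open Summit.Parity.GeneralizedHardyLittlewood.Theorems.BeyondDiagonalBeatsQuarter.KernelFormXSq
  (copTauW mainConst divWeight divWeight_nonneg mainConst_nonneg mainConst_le_divWeight abs_coprimeSum_sub_le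
    sum_prime_log_div_succ_le)
open Summit.Parity.GeneralizedHardyLittlewood.Theorems.MomentsBeyondDiagonal.DiagLines
  (sum_copTauW_mul_mul_sum_primeFactors_eq)


/-! ### The decorated engines -/

/-- **The prime-square decorated coprime Selberg sum, orders `c ≥ 3`.** There is `C_c` such that for all `n ≥ 1`, `y ≥ 1`:
`|Σ_{k≤y} a_n(k)·logᶜ(y/k)·Σ_{p∣k}log²p + 2·E_n·logᶜy| ≤ C_c·D(n)·(1+κ(n))·(1+log y)^{c−1}`
(`a_n = copTauW n`, `E_n = mainConst n`, `D(n) = divWeight n`, `κ = SelbergCoord.kappa`).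
[cite: KowalskiMichelVanderKam2000, (23)–(28) and Prop. 5.1 — derivation (prime-square decoration, real variables)] -/
theorem abs_coprimeSumPow_primeSq_add_le {c : ℕ} (hc : 3 ≤ c) :
    ∃ C : ℝ, 0 < C ∧ ∀ n : ℕ, n ≠ 0 → ∀ y : ℝ, 1 ≤ y →
      |∑ k ∈ Icc 1 ⌊y⌋₊, copTauW n k * Real.log (y / k) ^ c * ∑ p ∈ k.primeFactors, Real.log p ^ 2 +
          2 * mainConst n * Real.log y ^ c| ≤
        C * divWeight n * (1 + kappa n) * (1 + Real.log y) ^ (c - 1) := by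
  obtain ⟨C, hC0, hC⟩ := abs_coprimeSumPow_sub_le hc
  obtain ⟨C_E, hC_E, hE⟩ := mainConst_le_divWeight
  refine ⟨8 * C + 76 * (c : ℝ) ^ 2 * C_E, by positivity, fun n hn y hy ↦ ?_⟩
  have hy0 : 0 < y := by linarith
  have hly : 0 ≤ Real.log y := Real.log_nonneg hy
  have hκ : 0 ≤ kappa n := by
    unfold kappa
    exact Finset.sum_nonneg fun p hp ↦ by
      have hp2 : (2 : ℝ) ≤ p := by exact_mod_cast (Nat.prime_of_mem_primeFactors hp).two_le
      exact div_nonneg (Real.log_nonneg (by linarith)) (by linarith)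
  have hD := divWeight_nonneg n
  have hE0 := mainConst_nonneg n
  have hEn := hE n hn
  have hl4 : Real.log 4 ≤ 2 := by
    have := Real.log_two_lt_d9
    have h4 : Real.log 4 = 2 * Real.log 2 := by
      rw [show (4 : ℝ) = 2 ^ 2 by norm_num, Real.log_pow]; ring
    rw [h4]; linarith
  have hc0 : (c : ℝ) ≠ 0 := by exact_mod_cast (show c ≠ 0 by omega)
  have hc1 : (c : ℝ) - 1 ≠ 0 := by
    have : (3 : ℝ) ≤ c := by exact_mod_cast hc
    linarith
  have hcc : 0 ≤ (c : ℝ) * ((c : ℝ) - 1) := by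
    have : (3 : ℝ) ≤ c := by exact_mod_cast hc
    nlinarith
  set N := ⌊y⌋₊ with hN
  have hN1 : 1 ≤ N := by rw [hN]; exact Nat.one_le_floor_iff _ |>.2 hy
  have hlogN : Real.log N ≤ Real.log y :=
    Real.log_le_log (by exact_mod_cast hN1) (Nat.floor_le hy0.le)
  -- Step 1: the decorated sum as a prime sum of inner coprime sums
  have h := sum_copTauW_mul_mul_sum_primeFactors_eq n N (fun k : ℕ ↦ Real.log (y / k) ^ c)
    (fun p : ℕ ↦ Real.log p ^ 2)
  beta_reduce at h
  rw [h, Finset.sum_filter]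
  -- abbreviations
  obtain ⟨T, hT⟩ : ∃ T : ℕ → ℝ, ∀ p, T p = if p.Prime then Real.log p ^ 2 * copTauW n p *
      ∑ k ∈ Icc 1 (N / p), copTauW (n * p) k * Real.log (y / ((p * k : ℕ) : ℝ)) ^ c else 0 :=
    ⟨_, fun _ ↦ rfl⟩
  obtain ⟨v, hv⟩ : ∃ v : ℕ → ℝ, ∀ p, v p = if p.Prime ∧ ¬ p ∣ n then Real.log p / ((p : ℝ) - 1) else 0 :=
    ⟨_, fun _ ↦ rfl⟩
  simp only [← hT]
  set K : ℝ := 4 * C * divWeight n * (1 + Real.log y) ^ (c - 3) * Real.log y with hK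
  have hK0 : 0 ≤ K := by positivity
  set k : ℝ := -2 * ((c : ℝ) * ((c : ℝ) - 1)) * mainConst n with hk
  have hmain := abs_sum_primeWeight_log_mul_log_pow_sub_le hn hy (show 2 ≤ c by omega)
  simp only [← hv] at hmain
  have hterm : ∀ p ∈ Icc 1 N, |T p - k * (v p * (Real.log p * Real.log (y / p) ^ (c - 2)))| ≤
      if p.Prime ∧ ¬ p ∣ n then Real.log p / ((p : ℝ) + 1) * K else 0 := by
    intro p hp
    rw [hT p, hv p]
    exact abs_primeSq_term_sub_le hC0.le hC hn hy hp
  -- Step 2: split off the main part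
  have hsplit : ∑ p ∈ Icc 1 N, T p + 2 * mainConst n * Real.log y ^ c =
      ∑ p ∈ Icc 1 N, (T p - k * (v p * (Real.log p * Real.log (y / p) ^ (c - 2)))) +
        k * (∑ p ∈ Icc 1 N, v p * (Real.log p * Real.log (y / p) ^ (c - 2)) -
          Real.log y ^ c / ((c : ℝ) * ((c : ℝ) - 1))) := by
    rw [Finset.sum_sub_distrib, ← Finset.mul_sum, hk]
    field_simp
    ring
  rw [hsplit]
  -- Step 3: the two estimates
  have hA : |∑ p ∈ Icc 1 N, (T p - k * (v p * (Real.log p * Real.log (y / p) ^ (c - 2))))| ≤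
      K * (Real.log N + Real.log 4) := by
    calc _ ≤ ∑ p ∈ Icc 1 N, |T p - k * (v p * (Real.log p * Real.log (y / p) ^ (c - 2)))| :=
          Finset.abs_sum_le_sum_abs _ _
      _ ≤ ∑ p ∈ Icc 1 N, (if p.Prime ∧ ¬ p ∣ n then Real.log p / ((p : ℝ) + 1) * K else 0) :=
          Finset.sum_le_sum hterm
      _ ≤ K * (Real.log N + Real.log 4) := sum_prime_log_div_succ_le n N hK0
  have hB : |k * (∑ p ∈ Icc 1 N, v p * (Real.log p * Real.log (y / p) ^ (c - 2)) -
      Real.log y ^ c / ((c : ℝ) * ((c : ℝ) - 1)))| ≤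
      2 * ((c : ℝ) * ((c : ℝ) - 1)) * mainConst n * (2 * (19 + kappa n) * (1 + Real.log y) ^ (c - 1)) := by
    rw [abs_mul]
    have hkabs : |k| = 2 * ((c : ℝ) * ((c : ℝ) - 1)) * mainConst n := by
      rw [hk, abs_mul, abs_mul, abs_of_nonneg hcc, abs_of_nonneg hE0]
      norm_num
    rw [hkabs]
    exact mul_le_mul_of_nonneg_left hmain (by positivity)
  -- Step 4: assembly
  have hl40 : 0 ≤ Real.log 4 := Real.log_nonneg (by norm_num)
  have hlogN0 : 0 ≤ Real.log N := Real.log_natCast_nonneg N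
  have hX0 : 0 ≤ (1 + Real.log y) ^ (c - 1) := by positivity
  have hpow : (1 + Real.log y) ^ (c - 3) * Real.log y * (Real.log N + Real.log 4) ≤
      2 * (1 + Real.log y) ^ (c - 1) := by
    have e : c - 1 = (c - 3) + 2 := by omega
    have h1 : Real.log y ≤ 1 + Real.log y := by linarith
    have h2 : Real.log N + Real.log 4 ≤ 2 * (1 + Real.log y) := by linarith
    have hA : Real.log y * (Real.log N + Real.log 4) ≤ (1 + Real.log y) * (2 * (1 + Real.log y)) :=
      mul_le_mul h1 h2 (add_nonneg hlogN0 hl40) (by positivity)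
    calc (1 + Real.log y) ^ (c - 3) * Real.log y * (Real.log N + Real.log 4)
        = (1 + Real.log y) ^ (c - 3) * (Real.log y * (Real.log N + Real.log 4)) := by ring
      _ ≤ (1 + Real.log y) ^ (c - 3) * ((1 + Real.log y) * (2 * (1 + Real.log y))) :=
          mul_le_mul_of_nonneg_left hA (by positivity)
      _ = 2 * (1 + Real.log y) ^ (c - 1) := by rw [e, pow_add]; ring
  have hfirst : K * (Real.log N + Real.log 4) ≤ 8 * C * divWeight n * (1 + kappa n) * (1 + Real.log y) ^ (c - 1) := by
    calc K * (Real.log N + Real.log 4)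
        = 4 * C * divWeight n * ((1 + Real.log y) ^ (c - 3) * Real.log y * (Real.log N + Real.log 4)) := by
          rw [hK]; ring
      _ ≤ 4 * C * divWeight n * (2 * (1 + Real.log y) ^ (c - 1)) := mul_le_mul_of_nonneg_left hpow (by positivity)
      _ = 8 * C * divWeight n * 1 * (1 + Real.log y) ^ (c - 1) := by ring
      _ ≤ 8 * C * divWeight n * (1 + kappa n) * (1 + Real.log y) ^ (c - 1) := by
          apply mul_le_mul_of_nonneg_right _ hX0
          exact mul_le_mul_of_nonneg_left (by linarith) (by positivity)
  have hsecond : 2 * ((c : ℝ) * ((c : ℝ) - 1)) * mainConst n * (2 * (19 + kappa n) * (1 + Real.log y) ^ (c - 1)) ≤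
      76 * (c : ℝ) ^ 2 * C_E * divWeight n * (1 + kappa n) * (1 + Real.log y) ^ (c - 1) := by
    have i1 : (c : ℝ) * ((c : ℝ) - 1) ≤ (c : ℝ) ^ 2 := by nlinarith [(Nat.cast_nonneg c : (0 : ℝ) ≤ c)]
    have i2 : 19 + kappa n ≤ 19 * (1 + kappa n) := by linarith
    have i3 : ((c : ℝ) * ((c : ℝ) - 1)) * ((19 + kappa n) * mainConst n) ≤
        (c : ℝ) ^ 2 * ((19 * (1 + kappa n)) * (C_E * divWeight n)) :=
      mul_le_mul i1 (mul_le_mul i2 hEn hE0 (by positivity)) (by positivity) (by positivity)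
    calc 2 * ((c : ℝ) * ((c : ℝ) - 1)) * mainConst n * (2 * (19 + kappa n) * (1 + Real.log y) ^ (c - 1))
        = 4 * (((c : ℝ) * ((c : ℝ) - 1)) * ((19 + kappa n) * mainConst n)) * (1 + Real.log y) ^ (c - 1) := by ring
      _ ≤ 4 * ((c : ℝ) ^ 2 * ((19 * (1 + kappa n)) * (C_E * divWeight n))) * (1 + Real.log y) ^ (c - 1) := by
          apply mul_le_mul_of_nonneg_right _ hX0
          exact mul_le_mul_of_nonneg_left i3 (by norm_num)
      _ = 76 * (c : ℝ) ^ 2 * C_E * divWeight n * (1 + kappa n) * (1 + Real.log y) ^ (c - 1) := by ring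
  calc _ ≤ |∑ p ∈ Icc 1 N, (T p - k * (v p * (Real.log p * Real.log (y / p) ^ (c - 2))))| +
        |k * (∑ p ∈ Icc 1 N, v p * (Real.log p * Real.log (y / p) ^ (c - 2)) -
          Real.log y ^ c / ((c : ℝ) * ((c : ℝ) - 1)))| := abs_add_le _ _
    _ ≤ K * (Real.log N + Real.log 4) +
        2 * ((c : ℝ) * ((c : ℝ) - 1)) * mainConst n * (2 * (19 + kappa n) * (1 + Real.log y) ^ (c - 1)) :=
        add_le_add hA hB
    _ ≤ 8 * C * divWeight n * (1 + kappa n) * (1 + Real.log y) ^ (c - 1) +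
        76 * (c : ℝ) ^ 2 * C_E * divWeight n * (1 + kappa n) * (1 + Real.log y) ^ (c - 1) :=
        add_le_add hfirst hsecond
    _ = (8 * C + 76 * (c : ℝ) ^ 2 * C_E) * divWeight n * (1 + kappa n) * (1 + Real.log y) ^ (c - 1) := by ring

/-- **The prime-square decorated coprime Selberg sum, order `c = 2`.** There is `C` such that for all `n ≥ 1`, `y ≥ 1`:
`|Σ_{k≤y} a_n(k)·log²(y/k)·Σ_{p∣k}log²p + 2·E_n·log²y| ≤ C·D(n)·(1+κ(n))·(1+log y)`.
[cite: KowalskiMichelVanderKam2000, (23)–(28) and Prop. 5.1 — derivation (prime-square decoration, real variables)] -/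
theorem abs_coprimeSum_primeSq_add_le :
    ∃ C : ℝ, 0 < C ∧ ∀ n : ℕ, n ≠ 0 → ∀ y : ℝ, 1 ≤ y →
      |∑ k ∈ Icc 1 ⌊y⌋₊, copTauW n k * Real.log (y / k) ^ 2 * ∑ p ∈ k.primeFactors, Real.log p ^ 2 +
          2 * mainConst n * Real.log y ^ 2| ≤
        C * divWeight n * (1 + kappa n) * (1 + Real.log y) := by
  obtain ⟨C, hC0, hC⟩ := abs_coprimeSum_sub_le
  obtain ⟨C_E, hC_E, hE⟩ := mainConst_le_divWeight
  refine ⟨64 * C + 152 * C_E, by positivity, fun n hn y hy ↦ ?_⟩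
  have hy0 : 0 < y := by linarith
  have hly : 0 ≤ Real.log y := Real.log_nonneg hy
  have hκ : 0 ≤ kappa n := by
    unfold kappa
    exact Finset.sum_nonneg fun p hp ↦ by
      have hp2 : (2 : ℝ) ≤ p := by exact_mod_cast (Nat.prime_of_mem_primeFactors hp).two_le
      exact div_nonneg (Real.log_nonneg (by linarith)) (by linarith)
  have hD := divWeight_nonneg n
  have hE0 := mainConst_nonneg n
  have hEn := hE n hn
  have hl4 : Real.log 4 ≤ 2 := by
    have := Real.log_two_lt_d9
    have h4 : Real.log 4 = 2 * Real.log 2 := by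
      rw [show (4 : ℝ) = 2 ^ 2 by norm_num, Real.log_pow]; ring
    rw [h4]; linarith
  have hl40 : 0 ≤ Real.log 4 := Real.log_nonneg (by norm_num)
  set N := ⌊y⌋₊ with hN
  -- Step 1: the decorated sum as a prime sum of inner coprime sums
  have h := sum_copTauW_mul_mul_sum_primeFactors_eq n N (fun k : ℕ ↦ Real.log (y / k) ^ 2)
    (fun p : ℕ ↦ Real.log p ^ 2)
  beta_reduce at h
  rw [h, Finset.sum_filter]
  obtain ⟨T, hT⟩ : ∃ T : ℕ → ℝ, ∀ p, T p = if p.Prime then Real.log p ^ 2 * copTauW n p *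
      ∑ k ∈ Icc 1 (N / p), copTauW (n * p) k * Real.log (y / ((p * k : ℕ) : ℝ)) ^ 2 else 0 :=
    ⟨_, fun _ ↦ rfl⟩
  obtain ⟨v, hv⟩ : ∃ v : ℕ → ℝ, ∀ p, v p = if p.Prime ∧ ¬ p ∣ n then Real.log p / ((p : ℝ) - 1) else 0 :=
    ⟨_, fun _ ↦ rfl⟩
  simp only [← hT]
  set K : ℝ := 4 * C * divWeight n * Real.log y with hK
  have hK0 : 0 ≤ K := by positivity
  set k : ℝ := -4 * mainConst n with hk
  have hmain' : |∑ p ∈ Icc 1 N, v p * Real.log p - Real.log y ^ 2 / ((2 : ℝ) * ((2 : ℝ) - 1))| ≤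
      2 * (19 + kappa n) * (1 + Real.log y) := by
    have hm := abs_sum_primeWeight_log_mul_log_pow_sub_le hn hy (le_refl 2)
    simp only [← hv, show (2 : ℕ) - 2 = 0 from rfl, show (2 : ℕ) - 1 = 1 from rfl, pow_zero, mul_one, pow_one,
      Nat.cast_ofNat] at hm
    exact hm
  have hterm : ∀ p ∈ Icc 1 N, |T p - k * (v p * Real.log p)| ≤
      (if p.Prime then Real.log p else 0) / ((p : ℝ) * (1 + Real.log (y / p)) ^ 2) * K := by
    intro p hp
    rw [hT p, hv p]
    exact abs_primeSq_term_two_sub_le hC0.le hC hn hy hp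
  -- Step 2: split off the main part
  have hsplit : ∑ p ∈ Icc 1 N, T p + 2 * mainConst n * Real.log y ^ 2 =
      ∑ p ∈ Icc 1 N, (T p - k * (v p * Real.log p)) +
        k * (∑ p ∈ Icc 1 N, v p * Real.log p - Real.log y ^ 2 / ((2 : ℝ) * ((2 : ℝ) - 1))) := by
    rw [Finset.sum_sub_distrib, ← Finset.mul_sum, hk]
    ring
  rw [hsplit]
  have hA : |∑ p ∈ Icc 1 N, (T p - k * (v p * Real.log p))| ≤ 8 * Real.log 4 * K := by
    calc _ ≤ ∑ p ∈ Icc 1 N, |T p - k * (v p * Real.log p)| := Finset.abs_sum_le_sum_abs _ _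
      _ ≤ ∑ p ∈ Icc 1 N, (if p.Prime then Real.log p else 0) / ((p : ℝ) * (1 + Real.log (y / p)) ^ 2) * K :=
          Finset.sum_le_sum hterm
      _ = (∑ p ∈ Icc 1 N, (if p.Prime then Real.log p else 0) / ((p : ℝ) * (1 + Real.log (y / p)) ^ 2)) * K := by
          rw [Finset.sum_mul]
      _ ≤ 8 * Real.log 4 * K := mul_le_mul_of_nonneg_right (sum_prime_log_div_dyadic_le hy) hK0
  have hB : |k * (∑ p ∈ Icc 1 N, v p * Real.log p - Real.log y ^ 2 / ((2 : ℝ) * ((2 : ℝ) - 1)))| ≤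
      4 * mainConst n * (2 * (19 + kappa n) * (1 + Real.log y)) := by
    rw [abs_mul]
    have hkabs : |k| = 4 * mainConst n := by
      rw [hk, abs_mul, abs_of_nonneg hE0]; norm_num
    rw [hkabs]
    exact mul_le_mul_of_nonneg_left hmain' (by positivity)
  calc _ ≤ |∑ p ∈ Icc 1 N, (T p - k * (v p * Real.log p))| +
        |k * (∑ p ∈ Icc 1 N, v p * Real.log p - Real.log y ^ 2 / ((2 : ℝ) * ((2 : ℝ) - 1)))| := abs_add_le _ _
    _ ≤ 8 * Real.log 4 * K + 4 * mainConst n * (2 * (19 + kappa n) * (1 + Real.log y)) := add_le_add hA hB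
    _ = 32 * Real.log 4 * C * divWeight n * Real.log y + 8 * mainConst n * (19 + kappa n) * (1 + Real.log y) := by
        rw [hK]; ring
    _ ≤ 64 * C * divWeight n * (1 + kappa n) * (1 + Real.log y) +
        152 * C_E * divWeight n * (1 + kappa n) * (1 + Real.log y) := by
        have hL1 : Real.log y ≤ 1 + Real.log y := by linarith
        have i1 : 32 * Real.log 4 * C * divWeight n * Real.log y ≤ 64 * C * divWeight n * (1 + kappa n) * (1 + Real.log y) := by
          have j1 : 32 * Real.log 4 * C * divWeight n ≤ 64 * C * divWeight n * (1 + kappa n) := by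
            calc 32 * Real.log 4 * C * divWeight n ≤ 32 * 2 * C * divWeight n := by
                  have : 0 ≤ C * divWeight n := by positivity
                  nlinarith
              _ = 64 * C * divWeight n * 1 := by ring
              _ ≤ 64 * C * divWeight n * (1 + kappa n) :=
                  mul_le_mul_of_nonneg_left (by linarith) (by positivity)
          exact mul_le_mul j1 hL1 hly (by positivity)
        have i2 : 8 * mainConst n * (19 + kappa n) * (1 + Real.log y) ≤
            152 * C_E * divWeight n * (1 + kappa n) * (1 + Real.log y) := by
          apply mul_le_mul_of_nonneg_right _ (by positivity)
          have j2 : mainConst n * (19 + kappa n) ≤ (C_E * divWeight n) * (19 * (1 + kappa n)) :=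
            mul_le_mul hEn (by linarith) (by positivity) (by positivity)
          nlinarith [j2]
        exact add_le_add i1 i2
    _ = (64 * C + 152 * C_E) * divWeight n * (1 + kappa n) * (1 + Real.log y) := by ring

end Summit.Parity.GeneralizedHardyLittlewood.Theorems.MomentsBeyondDiagonal.DiagKernel

end
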